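import Literature.Analysis.FunctionSpaces.TorusAxisAverageCalculus
import Literature.Analysis.FunctionSpaces.SpaceTimeWeakCompactness
import HarnessLib

/-!
# Weak `L²` limits of axis-invariant fields are axis-invariant; pairings with planar lifts

Analysis/FunctionSpaces support file (theorem-only), on top of the tree's axis average
`Torus.axisAvg i` (`TorusAxisAverage`) and its calculus / planar-section API
(`TorusAxisAverageCalculus`: `integral_inner_eq_integral_inner_axisAvg`, `eLpNorm_axisAvg_le`,
`planarSect`, `planarShear`, `axisAvg_last_eq_comp`, `eLpNorm_axisAvg_comp_planarSect_le`).
The "uniformly bounded in `L^∞_t L²_x`, hence a subsequence converges weak-*" step of a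
compactness argument produces a limit `W` on `(0,T) × T^d`; when the approximating fields do not
depend on the coordinate `xᵢ` (two-and-a-half-dimensional fields, Majda–Bertozzi 2002, §2.3.1;
the third components `u₃^ν(x₁,x₂,t)` of Bardos–Titi–Wiedemann 2012, proof of Thm. 5), neither
does the limit. This file proves that statement at the level of functions, and the bookkeeping
reading such a limit on `T³` as a field on `T²`:

* slices: `Torus.ae_memLp_two_slice` (a.e. time slice of an `L²((vol|_S) ⊗ vol)` field is in
  `L²(T^d)`), `Torus.memLp_two_uncurry_axisAvg` (axis averaging acts on `L²((vol|_S) ⊗ vol)`);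
* real pairings (from `integral_inner_eq_integral_inner_axisAvg`):
  `Torus.integral_mul_eq_integral_mul_axisAvg` (an axis-invariant `L²` field paired with `B` only
  sees `axisAvg i B`) and **self-adjointness** `Torus.integral_mul_axisAvg_comm`
  (`∫ F · axisAvg G = ∫ axisAvg F · G` on `L²`);
* `Torus.ae_eq_axisAvg_of_tendsto` — **if axis-invariant fields `θ j` converge weakly in
  `L²((vol|_S) ⊗ vol)` to `W`, then `W t = axisAvg i (W t)` a.e., for a.e. `t ∈ S`** (pair with
  `G` and with `axisAvg G` — the same numbers — then move the average onto `W` and test with the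
  difference);
* `T³ → T²` (the case `d = Fin 3`, `i = Fin.last 2`; the descended field is the tree's
  `axisAvg (Fin.last 2) W ∘ planarSect`, the lift is `g ∘ planarProj`, `planarProj = Fin.init`
  definitionally): `Torus.integral_mul_comp_planarProj_eq` — **the adjunction**
  `∫_{T³} F · (g ∘ planarProj) = ∫_{T²} (axisAvg e₃ F ∘ planarSect) · g` for `L²` data — its
  time-integrated form `Torus.setIntegral_integral_mul_comp_planarProj_eq`, and the joint
  measurability of the descended space–time field
  (`Torus.aestronglyMeasurable_uncurry_axisAvg_comp_planarSect`, `…_stLift_…`).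

## References

* A. J. Majda, A. L. Bertozzi, *Vorticity and Incompressible Flow* (CUP 2002), §2.3.1.
* C. Bardos, E. S. Titi, E. Wiedemann, C. R. Math. 350 (2012) 757–760, proof of Thm. 5.
* H. Brezis, *Functional Analysis* (2011), Prop. 3.5 (iii) (uniqueness of weak limits).
-/

open MeasureTheory Set Filter Function
open scoped ENNReal NNReal InnerProductSpace RealInnerProductSpace

noncomputable section

namespace Literature.Analysis.FunctionSpaces.Torus

open _root_.Topology

variable {d : Type*} [Fintype d]

/-! ## Slices of `L²((vol|_S) ⊗ vol)` fields -/

section Slices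

/-- **A.e. time slice of an `L²((vol|_S) ⊗ vol_{T^d})` field lies in `L²(T^d)`** (Fubini for
`‖f‖²`). [folklore] -/
theorem ae_memLp_two_slice {S : Set ℝ} {f : ℝ → UnitAddTorus d → ℝ}
    (hf : MemLp (uncurry f) 2 (((volume : Measure ℝ).restrict S).prod volume)) :
    ∀ᵐ t ∂((volume : Measure ℝ).restrict S), MemLp (f t) 2 volume := by
  have h1 : ∀ᵐ t ∂((volume : Measure ℝ).restrict S), AEStronglyMeasurable (f t) volume :=
    hf.1.prodMk_left
  have h2 := (hf.integrable_norm_pow two_ne_zero).prod_right_ae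
  filter_upwards [h1, h2] with t ht ht'
  exact (memLp_two_iff_integrable_sq_norm ht).2 ht'

variable [DecidableEq d]

/-- **Slicewise `L²` contraction of the axis average, a.e. in time**:
`∫ ‖axisAvg i (F t)‖ₑ² ≤ ∫ ‖F t‖ₑ²` for a.e. `t ∈ S` (`eLpNorm_axisAvg_le`). [folklore] -/
theorem ae_lintegral_enorm_axisAvg_sq_le {S : Set ℝ} (i : d) {F : ℝ → UnitAddTorus d → ℝ}
    (hF : AEStronglyMeasurable (uncurry F) (((volume : Measure ℝ).restrict S).prod volume)) :
    ∀ᵐ t ∂((volume : Measure ℝ).restrict S),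
      ∫⁻ x, ‖axisAvg i (F t) x‖ₑ ^ 2 ≤ ∫⁻ x, ‖F t x‖ₑ ^ 2 := by
  filter_upwards [hF.prodMk_left] with t ht
  rw [← eLpNorm_two_pow_two_eq_lintegral, ← eLpNorm_two_pow_two_eq_lintegral]
  exact pow_le_pow_left' (eLpNorm_axisAvg_le i ht) 2

/-- **Axis averaging acts on `L²((vol|_S) ⊗ vol_{T^d})`** (joint measurability
`aestronglyMeasurable_uncurry_axisAvg`, norm by the slicewise contraction and Tonelli). [folklore] -/
theorem memLp_two_uncurry_axisAvg {S : Set ℝ} (i : d) {F : ℝ → UnitAddTorus d → ℝ}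
    (hF : MemLp (uncurry F) 2 (((volume : Measure ℝ).restrict S).prod volume)) :
    MemLp (uncurry fun t => axisAvg i (F t)) 2 (((volume : Measure ℝ).restrict S).prod volume) := by
  have hm : AEStronglyMeasurable (uncurry fun t => axisAvg i (F t)) (((volume : Measure ℝ).restrict S).prod volume) :=
    aestronglyMeasurable_uncurry_axisAvg hF.1 i
  refine ⟨hm, ?_⟩
  have h1 : eLpNorm (uncurry fun t => axisAvg i (F t)) 2 (((volume : Measure ℝ).restrict S).prod volume) ^ 2 ≤
      eLpNorm (uncurry F) 2 (((volume : Measure ℝ).restrict S).prod volume) ^ 2 := by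
    rw [eLpNorm_two_pow_two_eq_lintegral, eLpNorm_two_pow_two_eq_lintegral,
      lintegral_prod _ (hm.enorm.pow_const 2), lintegral_prod _ (hF.1.enorm.pow_const 2)]
    exact lintegral_mono_ae (ae_lintegral_enorm_axisAvg_sq_le i hF.1)
  have h2 : eLpNorm (uncurry F) 2 (((volume : Measure ℝ).restrict S).prod volume) ^ 2 < ∞ :=
    ENNReal.pow_lt_top hF.eLpNorm_lt_top
  rw [eLpNorm_two_eq_pow_two_rpow_half]
  exact ENNReal.rpow_lt_top_of_nonneg (by norm_num) (h1.trans_lt h2).ne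

end Slices

/-! ## Real pairings with axis-invariant fields; self-adjointness of the axis average -/

section Pairing

variable [DecidableEq d]

/-- **An axis-invariant `L²` field paired with `B ∈ L²` only sees `axisAvg i B`** (real form of
`integral_inner_eq_integral_inner_axisAvg`): `∫ A B = ∫ A · axisAvg i B`. [folklore] -/
theorem integral_mul_eq_integral_mul_axisAvg (i : d) {A B : UnitAddTorus d → ℝ}
    (hA : ∀ (s : UnitAddCircle) (x : UnitAddTorus d), A (x + Pi.single i s) = A x)
    (hAL : MemLp A 2 volume) (hBL : MemLp B 2 volume) :
    ∫ x, A x * B x = ∫ x, A x * axisAvg i B x := by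
  have h := integral_inner_eq_integral_inner_axisAvg i hA hAL.1 (hBL.integrable one_le_two)
    (integrable_inner_shift_of_memLp i hAL hBL)
  simp only [RCLike.inner_apply, conj_trivial] at h
  calc ∫ x, A x * B x = ∫ x, B x * A x := integral_congr_ae (ae_of_all _ fun x => mul_comm _ _)
    _ = ∫ x, axisAvg i B x * A x := h
    _ = ∫ x, A x * axisAvg i B x := integral_congr_ae (ae_of_all _ fun x => mul_comm _ _)

/-- **The axis average is self-adjoint on `L²(T^d)`**: `∫ F · axisAvg i G = ∫ axisAvg i F · G`
(apply the previous identity to the invariant fields `axisAvg i F` and `axisAvg i G`). [folklore] -/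
theorem integral_mul_axisAvg_comm (i : d) {F G : UnitAddTorus d → ℝ} (hF : MemLp F 2 volume)
    (hG : MemLp G 2 volume) :
    ∫ x, F x * axisAvg i G x = ∫ x, axisAvg i F x * G x := by
  have h1 := integral_mul_eq_integral_mul_axisAvg i (axisAvg_add_single i F) (memLp_axisAvg i hF) hG
  have h2 := integral_mul_eq_integral_mul_axisAvg i (axisAvg_add_single i G) (memLp_axisAvg i hG) hF
  calc ∫ x, F x * axisAvg i G x = ∫ x, axisAvg i G x * F x :=
        integral_congr_ae (ae_of_all _ fun x => mul_comm _ _)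
    _ = ∫ x, axisAvg i G x * axisAvg i F x := h2
    _ = ∫ x, axisAvg i F x * axisAvg i G x := integral_congr_ae (ae_of_all _ fun x => mul_comm _ _)
    _ = ∫ x, axisAvg i F x * G x := h1.symm

end Pairing

/-! ## Weak limits of axis-invariant fields -/

section WeakLimit

variable [DecidableEq d]

/-- **Weak `L²` limits of axis-invariant fields are axis-invariant.** Let
`θ j : ℝ → T^d → ℝ` be space–time fields in `L²((vol|_S) ⊗ vol)` with
`θ j t (x + s eᵢ) = θ j t x`, converging weakly to `W ∈ L²`: `∫_S∫ θ j G → ∫_S∫ W G` for every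
`G ∈ L²`. Then for a.e. `t ∈ S`, `W t = axisAvg i (W t)` a.e. on `T^d`. Proof: pairing the `θ j`
with `G` or with `axisAvg i (G t)` gives the same numbers (`integral_mul_eq_integral_mul_axisAvg`),
so `∫∫ W G = ∫∫ W · axisAvg G = ∫∫ axisAvg W · G` (self-adjointness); test with the difference
`W - axisAvg W`. This is the step "the weak-* limit `u₃ = u₃(x₁, x₂, t)`" of
Bardos–Titi–Wiedemann 2012, proof of Thm. 5. [folklore] -/
theorem ae_eq_axisAvg_of_tendsto {S : Set ℝ} (i : d) {θ : ℕ → ℝ → UnitAddTorus d → ℝ}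
    {W : ℝ → UnitAddTorus d → ℝ}
    (hθinv : ∀ j t (s : UnitAddCircle) x, θ j t (x + Pi.single i s) = θ j t x)
    (hθ : ∀ j, MemLp (uncurry (θ j)) 2 (((volume : Measure ℝ).restrict S).prod volume))
    (hW : MemLp (uncurry W) 2 (((volume : Measure ℝ).restrict S).prod volume))
    (hweak : ∀ G : ℝ → UnitAddTorus d → ℝ,
      MemLp (uncurry G) 2 (((volume : Measure ℝ).restrict S).prod volume) →
      Tendsto (fun j => ∫ t in S, ∫ x, θ j t x * G t x) atTop (𝓝 (∫ t in S, ∫ x, W t x * G t x))) :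
    ∀ᵐ t ∂((volume : Measure ℝ).restrict S), W t =ᵐ[volume] axisAvg i (W t) := by
  have hAL := memLp_two_uncurry_axisAvg i hW
  -- Step 1: `∫∫ W G = ∫∫ axisAvg W · G` for every `G ∈ L²`
  have hkey : ∀ G : ℝ → UnitAddTorus d → ℝ,
      MemLp (uncurry G) 2 (((volume : Measure ℝ).restrict S).prod volume) →
      ∫ t in S, ∫ x, W t x * G t x = ∫ t in S, ∫ x, axisAvg i (W t) x * G t x := by
    intro G hG
    have hBL := memLp_two_uncurry_axisAvg i hG
    -- (i) the pairings with `θ j` agree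
    have hi : ∀ j, ∫ t in S, ∫ x, θ j t x * G t x = ∫ t in S, ∫ x, θ j t x * axisAvg i (G t) x := by
      intro j
      refine integral_congr_ae ?_
      filter_upwards [ae_memLp_two_slice (hθ j), ae_memLp_two_slice hG] with t h1 h2
      exact integral_mul_eq_integral_mul_axisAvg i (hθinv j t) h1 h2
    -- (ii) hence the two weak limits agree
    have h1 : Tendsto (fun j => ∫ t in S, ∫ x, θ j t x * axisAvg i (G t) x) atTop
        (𝓝 (∫ t in S, ∫ x, W t x * G t x)) := (hweak G hG).congr hi
    have h2 := hweak _ hBL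
    have heq : ∫ t in S, ∫ x, W t x * G t x = ∫ t in S, ∫ x, W t x * axisAvg i (G t) x :=
      tendsto_nhds_unique h1 h2
    -- (iii) move the average onto `W`
    rw [heq]
    refine integral_congr_ae ?_
    filter_upwards [ae_memLp_two_slice hW, ae_memLp_two_slice hG] with t h3 h4
    exact integral_mul_axisAvg_comm i h3 h4
  -- Step 2: test with the difference `D = W - axisAvg W`
  set D : ℝ → UnitAddTorus d → ℝ := fun t x => W t x - axisAvg i (W t) x with hD
  have hDL : MemLp (uncurry D) 2 (((volume : Measure ℝ).restrict S).prod volume) := hW.sub hAL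
  have hDD : Integrable (uncurry fun t x => D t x * D t x)
      (((volume : Measure ℝ).restrict S).prod volume) := hDL.integrable_mul hDL
  have hzero : ∫ t in S, ∫ x, D t x * D t x = 0 := by
    have hsplit : ∀ t x, D t x * D t x = W t x * D t x - axisAvg i (W t) x * D t x := by
      intro t x; simp only [hD]; ring
    simp_rw [hsplit]
    have hsub := integral_integral_sub (μ := (volume : Measure ℝ).restrict S)
      (ν := (volume : Measure (UnitAddTorus d))) (hW.integrable_mul hDL) (hAL.integrable_mul hDL)
    simp only [Pi.mul_apply, uncurry_apply_pair] at hsub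
    rw [hsub, hkey D hDL, sub_self]
  have hprod : ∫ z, (uncurry fun t x => D t x * D t x) z
      ∂(((volume : Measure ℝ).restrict S).prod (volume : Measure (UnitAddTorus d))) = 0 := by
    rw [integral_prod _ hDD]
    exact hzero
  have hae := (integral_eq_zero_iff_of_nonneg (f := uncurry fun t x => D t x * D t x)
    (fun z => mul_self_nonneg _) hDD).1 hprod
  have hae' : ∀ᵐ z ∂(((volume : Measure ℝ).restrict S).prod (volume : Measure (UnitAddTorus d))),
      D z.1 z.2 = 0 := by
    filter_upwards [hae] with z hz
    have hz' : D z.1 z.2 * D z.1 z.2 = 0 := hz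
    exact mul_self_eq_zero.1 hz'
  filter_upwards [Measure.ae_ae_of_ae_prod hae'] with t ht
  filter_upwards [ht] with x hx
  simp only [hD] at hx
  exact sub_eq_zero.1 hx

end WeakLimit

/-! ## `T³ → T²`: pairings with planar lifts, the descended field -/

section Three

/-- **The adjunction between planar lifts and the descended third-axis average**: for
`F ∈ L²(T³)` and `g ∈ L²(T²)`,
`∫_{T³} F(x) g(x₁,x₂) dx = ∫_{T²} (axisAvg e₃ F ∘ planarSect)(y) g(y) dy`
(`integral_mul_eq_integral_mul_axisAvg` for the invariant lift `g ∘ planarProj`,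
`axisAvg_last_eq_comp`, `integral_comp_planarProj`). Here `planarProj x = Fin.init x = (x₀, x₁)`
definitionally. [folklore] -/
theorem integral_mul_comp_planarProj_eq {F : UnitAddTorus (Fin 3) → ℝ} {g : UnitAddTorus (Fin 2) → ℝ}
    (hF : MemLp F 2 volume) (hg : MemLp g 2 volume) :
    ∫ x, F x * g (planarProj x) = ∫ y, (axisAvg (Fin.last 2) F ∘ planarSect) y * g y := by
  have hgL : MemLp (fun x : UnitAddTorus (Fin 3) => g (planarProj x)) 2 volume :=
    hg.comp_measurePreserving measurePreserving_planarProj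
  have hinv : ∀ (s : UnitAddCircle) (x : UnitAddTorus (Fin 3)),
      g (planarProj (x + Pi.single (Fin.last 2) s)) = g (planarProj x) :=
    fun s x => comp_planarProj_add_single g s x
  have h1 : ∫ x, g (planarProj x) * F x = ∫ x, g (planarProj x) * axisAvg (Fin.last 2) F x :=
    integral_mul_eq_integral_mul_axisAvg (Fin.last 2) hinv hgL hF
  have h2 : ∀ x : UnitAddTorus (Fin 3), axisAvg (Fin.last 2) F x =
      (axisAvg (Fin.last 2) F ∘ planarSect) (planarProj x) := fun x =>
    congrFun (axisAvg_last_eq_comp F) x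
  have hm : AEStronglyMeasurable (fun y => g y * (axisAvg (Fin.last 2) F ∘ planarSect) y)
      (volume : Measure (UnitAddTorus (Fin 2))) :=
    hg.1.mul (aestronglyMeasurable_axisAvg_comp_planarSect hF.1)
  calc ∫ x, F x * g (planarProj x) = ∫ x, g (planarProj x) * F x :=
        integral_congr_ae (ae_of_all _ fun x => mul_comm _ _)
    _ = ∫ x, g (planarProj x) * axisAvg (Fin.last 2) F x := h1
    _ = ∫ x, g (planarProj x) * (axisAvg (Fin.last 2) F ∘ planarSect) (planarProj x) := by
        simp_rw [← h2]
    _ = ∫ y, g y * (axisAvg (Fin.last 2) F ∘ planarSect) y :=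
        integral_comp_planarProj (b := fun y => g y * (axisAvg (Fin.last 2) F ∘ planarSect) y) hm
    _ = ∫ y, (axisAvg (Fin.last 2) F ∘ planarSect) y * g y :=
        integral_congr_ae (ae_of_all _ fun y => mul_comm _ _)

/-- **The time-integrated adjunction**: for `F ∈ L²((vol|_S) ⊗ vol_{T³})` and
`g ∈ L²((vol|_S) ⊗ vol_{T²})`,
`∫_S∫_{T³} F t x · g t (x₀,x₁) = ∫_S∫_{T²} (axisAvg e₃ (F t) ∘ planarSect) · g t`. [folklore] -/
theorem setIntegral_integral_mul_comp_planarProj_eq {S : Set ℝ} {F : ℝ → UnitAddTorus (Fin 3) → ℝ}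
    {g : ℝ → UnitAddTorus (Fin 2) → ℝ}
    (hF : MemLp (uncurry F) 2 (((volume : Measure ℝ).restrict S).prod volume))
    (hg : MemLp (uncurry g) 2 (((volume : Measure ℝ).restrict S).prod volume)) :
    ∫ t in S, ∫ x, F t x * g t (planarProj x) =
      ∫ t in S, ∫ y, (axisAvg (Fin.last 2) (F t) ∘ planarSect) y * g t y := by
  refine integral_congr_ae ?_
  filter_upwards [ae_memLp_two_slice hF, ae_memLp_two_slice hg] with t h1 h2
  exact integral_mul_comp_planarProj_eq h1 h2

/-- Planar lifts of `L²((vol|_S) ⊗ vol_{T²})` fields are in `L²((vol|_S) ⊗ vol_{T³})`. [folklore] -/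
theorem memLp_two_uncurry_comp_planarProj {S : Set ℝ} {g : ℝ → UnitAddTorus (Fin 2) → ℝ}
    (hg : MemLp (uncurry g) 2 (((volume : Measure ℝ).restrict S).prod volume)) :
    MemLp (uncurry fun t (x : UnitAddTorus (Fin 3)) => g t (planarProj x)) 2
      (((volume : Measure ℝ).restrict S).prod volume) :=
  hg.comp_measurePreserving ((MeasurePreserving.id ((volume : Measure ℝ).restrict S)).prod
    measurePreserving_planarProj)

/-- `((t, y), s) ↦ (t, planarShear (y, s))` preserves `((vol|_S) ⊗ vol_{T²}) ⊗ vol → (vol|_S) ⊗ vol_{T³}`. [folklore] -/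
theorem measurePreserving_planarShear_spaceTime (S : Set ℝ) :
    MeasurePreserving
      (fun q : (ℝ × UnitAddTorus (Fin 2)) × UnitAddCircle => (q.1.1, planarShear (q.1.2, q.2)))
      ((((volume : Measure ℝ).restrict S).prod (volume : Measure (UnitAddTorus (Fin 2)))).prod
        (volume : Measure UnitAddCircle))
      (((volume : Measure ℝ).restrict S).prod (volume : Measure (UnitAddTorus (Fin 3)))) := by
  have h1 := (MeasurePreserving.id ((volume : Measure ℝ).restrict S)).prod measurePreserving_planarShear
  have h2 := measurePreserving_prodAssoc ((volume : Measure ℝ).restrict S)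
    (volume : Measure (UnitAddTorus (Fin 2))) (volume : Measure UnitAddCircle)
  exact h1.comp h2

/-- **Joint measurability of the descended space–time field**
`(t, y) ↦ (axisAvg e₃ (W t) ∘ planarSect) y = ∫ W t (planarShear (y, s)) ds` (a parametric
integral of `uncurry W` composed with `measurePreserving_planarShear_spaceTime`). [folklore] -/
theorem aestronglyMeasurable_uncurry_axisAvg_comp_planarSect {S : Set ℝ} {W : ℝ → UnitAddTorus (Fin 3) → ℝ}
    (hW : AEStronglyMeasurable (uncurry W) (((volume : Measure ℝ).restrict S).prod volume)) :
    AEStronglyMeasurable (uncurry fun t => axisAvg (Fin.last 2) (W t) ∘ planarSect)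
      (((volume : Measure ℝ).restrict S).prod volume) :=
  (hW.comp_measurePreserving (measurePreserving_planarShear_spaceTime S)).integral_prod_right'

/-- The same through the space–time lifts. [folklore] -/
theorem aestronglyMeasurable_stLift_axisAvg_comp_planarSect {S : Set ℝ} {W : ℝ → UnitAddTorus (Fin 3) → ℝ}
    (hW : AEStronglyMeasurable (stLift W) (volume.restrict (S ×ˢ univ))) :
    AEStronglyMeasurable (stLift fun t => axisAvg (Fin.last 2) (W t) ∘ planarSect)
      (volume.restrict (S ×ˢ (univ : Set (EuclideanSpace ℝ (Fin 2))))) :=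
  aestronglyMeasurable_stLift_of_uncurry
    (aestronglyMeasurable_uncurry_axisAvg_comp_planarSect (aestronglyMeasurable_uncurry_of_stLift_prod hW))

/-- **Slicewise `L²` bound of the descended field, a.e. in time**:
`∫_{T²} ‖(axisAvg e₃ (W t) ∘ planarSect)‖ₑ² ≤ ∫_{T³} ‖W t‖ₑ²` (`eLpNorm_axisAvg_comp_planarSect_le`). [folklore] -/
theorem ae_lintegral_enorm_axisAvg_comp_planarSect_sq_le {S : Set ℝ} {W : ℝ → UnitAddTorus (Fin 3) → ℝ}
    (hW : AEStronglyMeasurable (uncurry W) (((volume : Measure ℝ).restrict S).prod volume)) :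
    ∀ᵐ t ∂((volume : Measure ℝ).restrict S),
      ∫⁻ y, ‖(axisAvg (Fin.last 2) (W t) ∘ planarSect) y‖ₑ ^ 2 ≤ ∫⁻ x, ‖W t x‖ₑ ^ 2 := by
  filter_upwards [hW.prodMk_left] with t ht
  rw [← eLpNorm_two_pow_two_eq_lintegral, ← eLpNorm_two_pow_two_eq_lintegral]
  exact pow_le_pow_left' (eLpNorm_axisAvg_comp_planarSect_le ht) 2

end Three

end Literature.Analysis.FunctionSpaces.Torus

end
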